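import Summits.Ventures.CertifiedManyBodySolver.Downfold.BoxesLa214V115M2cPhaseSeparationThermalCuprateAnchor
import Summits.Ventures.CertifiedManyBodySolver.Observables.PhaseSeparationExclusionBoxThermalFreeDilute
import Summits.Ventures.CertifiedManyBodySolver.Certificates.HubbardTTPrime_freeGC_kernelQuadrature_b8_tpm1o4_dilute
import Summits.Ventures.CertifiedManyBodySolver.Certificates.HubbardTTPrime_freeGC_kernelQuadrature_b8_tpm1o5_dilute
import HarnessLib

/-!
# Ventures/CertifiedManyBodySolver — Downfold/BoxesLa214V115M2cPhaseSeparationThermalFreeDilute.lean: the LSCO `x = 1/8` box's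
# competing-order cells at `T > 0` RE-PRICED with the FREE-GAS DILUTE ANCHOR — right `t′`-half `[−1/4, −1/5]`: `(≤ 1/5 | ≥ 1)`
# excluded ∀ `β ≥ 10` on `U ∈ [8, 81/10]` (was `12`), ∀ `β ≥ 15` on `[79/10, 81/10]`, ∀ `β ≥ 20` on the wide `[38/5, 43/5]` (was `24`);
# `(≤ 1/4 | ≥ 1)` ∀ `β ≥ 16` on `[8, 81/10]` (was `21`), ∀ `β ≥ 24` on `[79/10, 81/10]` (was `29`)

HONEST FRAMING: first certified bounds; not a superconductivity verdict. CLASS = DERIVED / CONTEXT on a SCREENING-GRADE material box — CONTROL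
class (the excluded partner phase is DILUTE, density `≤ 1/5` resp. `≤ 1/4`, hole doping `≥ 80 %` / `≥ 75 %`); conditional BY NAME on exactly
the claim nodes of the parents (`…ThermalCuprateAnchor.lean` g24, `…ThermalHotAnchorCells.lean` g20): VARBOX plane
`cert_obx32x4tpm1o4D1200_openbox_32x4_N112_planes`, K2DIAG-A bootstraps `cert_laBoxE_K2diag_GU29o5n1tpm3o10_j295889_up` /
`cert_laBoxE_K2diag_GU8n1tpm3o10_j299783_up`, registry #21 · #487 · #427 · #488 · #472 · #428, the `n = 1` anchors
`cert_feC1tt_stair221_tpm1o4_b2_j300793` (cuprate point, `β_h = 2`, read at `n = 1`, band `|t′| ≤ 1/4 × U ≥ 8`) and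
`cert_feC1tt_3x2_tpm5o16_U15o2_b3o4_j290715` (`β_h = 3/4`, band `|t′| ≤ 5/16 × U ≥ 15/2`), and the premise-free kernel Fermi-sea tangent
rows (`lsco_dilute14_floor_right`). WHAT IS NEW (g25, filling lane): the DILUTE partner's anchor is no longer the a-priori `2H_b(n₁/2)`
(`0.666` / `0.77`) at `β_h = 0` but the FREE `t–t′` FERMI GAS at `β_h = 8` — `p(8; 1, s, U; n₁) ≤ P₀(8, s, μ) − 8μn₁` for every `U ≥ 0`
(antitone in `U`; `Literature/…/HubbardTTPrimeFreeGCPressure.lean`), `P₀` certified IN THE KERNEL (`Certificates/HubbardTTPrime_freeGC_kernelQuadrature_b8_*_dilute.lean`,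
NO claim node), chorded in `t′` between the cell's ends (`Observables/PhaseSeparationExclusionBoxThermalFreeDilute.lean`); the staircase
`8 → β` runs on the kinematic tangent row, exact for the free gas, so the dilute bracket `Q₁(s) + 8·F₁(s)` is `0.026–0.067` here (exact scan
`gen-g25/common.py`) instead of `0.666 / 0.77`. THRESHOLDS `β₀ = max over column ends of [a Q₁(s) + bΠ + 8a F₁(s) + β_h b L(s)]/M(s, U)`
(temperature readings on the box's `t ∈ [0.34, 0.40]` eV [float]):
* §1 `(≤ 1/5 | ≥ 1)` on `t′ ∈ [−1/4, −1/5]`: above `U ∈ [8, 81/10]` every `β ≥ 10` (`β₀ = 9.63`; g24: `12`) — `T ≲ 395–464 K`; above `[8, 83/10]`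
  every `β ≥ 12` (`11.39`; g24: `14`); above `[8, 43/5]` every `β ≥ 16` (`15.70`); columns `[79/10, 8]` every `β ≥ 15` (`14.39`), `[38/5, 8]`
  every `β ≥ 20` (`19.90`); unions: `[79/10, 81/10]` every `β ≥ 15`, WIDE `[38/5, 43/5]` every `β ≥ 20` (g24: `24`) — `T ≲ 197–232 K`;
* §2 `(≤ 1/4 | ≥ 1)` on `t′ ∈ [−1/4, −1/5]`: above `[8, 81/10]` every `β ≥ 16` (`15.87`; g24: `21`) — `T ≲ 247–290 K`; above `[8, 83/10]`
  every `β ≥ 22` (`21.29`); columns `[79/10, 8]` every `β ≥ 24` (`23.84`); union `[79/10, 81/10]` every `β ≥ 24` (g24: `29`).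
READING (D-0098 `T`-axis cell annotation, CONTROL): «LSCO x = 1/8 one-band box, t′/t ∈ [−0.25, −0.20] × U/t ∈ [8.0, 8.1]: at T ≲ 400 K no
macroscopic phase separation of the thermal state into the half-filled (or denser) phase and a phase of hole doping ≥ 80 %; at T ≲ 250 K
none with a phase of hole doping ≥ 75 %». Statements about canonical thermal torus-limit states (any sector density); nothing about stripes,
about which phase is realised, about superconductivity or `T_c`; nothing about La₁.₈₇₅Sr₀.₁₂₅CuO₄ itself; no number of record. Zero kit.

Cell `pub/hubbard-downfold` (MO-S1 ↔ S2 seam «box ↦ one word»; D-0096 (ii)/(iii), `T` axis of the D-0098 map), seat `hubbard-downfold-unc-2`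
(`prover-hubbard-downfold-unc-2-g25-0`). Forms: `psT_not_thermal_mix_{above_column,on_cell_of_columns}_hotAnchorSS` (g25). Generator
`gen-g25/gen_W1.py` (asserts every typed inequality in exact rationals).
WHAT THIS IS NOT: a certificate; a statement at other `U`, `t′` or `β`; the `n₂`-anchors remain PRODUCER-CERTIFIED claim nodes.
References: R. B. Israel, *Convexity in the Theory of Lattice Gases* (1979) Thm I.2.4 / I.3.4 [Israel1979]; D. Poulin, M. B. Hastings, PRL 106
(2011) 080403 [PoulinHastings2011]; D. Ruelle, *Statistical Mechanics* (1969) §3.3–3.4 [Ruelle1969]; R. B. Griffiths, J. Math. Phys. 5 (1964)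
1215 [Griffiths1966]; V. J. Emery, S. A. Kivelson, H. Q. Lin, PRL 64 (1990) 475 [EmeryKivelsonLin1990].
-/

noncomputable section

namespace Summit.Ventures.CertifiedManyBodySolver.Downfold

open Summit.Ventures.CertifiedManyBodySolver.Observables
open Summit.Ventures.CertifiedManyBodySolver.Certificates
open Literature.MathematicalPhysics.QuantumLattice Literature.MathematicalPhysics.QuantumLattice.ThermodynamicLimit
open Literature.MathematicalPhysics.QuantumLattice.InfVolFermionState Set Filter

/-! ## §0 The free-gas dilute anchors on the right `t′`-half `[−1/4, −1/5]` -/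

/-- **FREE-GAS DILUTE ANCHOR at `n₁ = 1/5` on `t′ ∈ [-1/4, -1/5]`** (right half of the LSCO cell; `β_h = 8`, every `U ≥ 0`): the `t′`-chord of the kernel ceilings
`P₀(8, -1/4, -477/200) ≤ 277441/500000` and `P₀(8, -1/5, -619/250) ≤ 629091/1000000` (`Certificates/HubbardTTPrime_freeGC_kernelQuadrature_b8_*_dilute.lean`) Legendre-shifted to
density `1/5`: `p(8; 1, s, U; 1/5) ≤ chord(4.3708820 @ -1/4, 4.5906910 @ -1/5)` — replaces the a-priori `2H_b(1/5/2)`. [cite: Ruelle1969, §3.4] [cite: Israel1979, Thm. I.3.4] -/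
theorem lsco_freeDiluteCap_1o5_right {s₁ s₂ U₁ U₂ : ℝ} (hs₁ : -1 / 4 ≤ s₁) (hs₂ : s₂ ≤ -1 / 5) (hU₁ : 0 ≤ U₁) :
    ∀ s ∈ Icc s₁ s₂, ∀ U ∈ Icc U₁ U₂, pressureTT' (8 : ℝ) 1 s U (1 / 5 : ℝ) ≤
      ((-1 / 5 - s) * ((277441 / 500000 : ℝ) - 8 * (-477 / 200) * (1 / 5)) + (s - (-1 / 4)) * ((629091 / 1000000 : ℝ) - 8 * (-619 / 250) * (1 / 5))) /
        (-1 / 5 - (-1 / 4)) := by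
  have hA := freeGCPressureTT'_b8_tpm1o4_n1o5_le
  have hB := freeGCPressureTT'_b8_tpm1o5_n1o5_le
  push_cast at hA hB
  exact pressureTT'_le_schord_of_freeGCPressureTT' (βh := 8) (by norm_num) (n := 1 / 5) (by norm_num) (by norm_num)
    (sa := -1 / 4) (sb := -1 / 5) (by norm_num) hA hB hs₁ hs₂ hU₁

/-- **FREE-GAS DILUTE ANCHOR at `n₁ = 1/4` on `t′ ∈ [-1/4, -1/5]`** (right half of the LSCO cell; `β_h = 8`, every `U ≥ 0`): the `t′`-chord of the kernel ceilings
`P₀(8, -1/4, -559/250) ≤ 205801/250000` and `P₀(8, -1/5, -288/125) ≤ 469413/500000` (`Certificates/HubbardTTPrime_freeGC_kernelQuadrature_b8_*_dilute.lean`) Legendre-shifted to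
density `1/4`: `p(8; 1, s, U; 1/4) ≤ chord(5.2952040 @ -1/4, 5.5468260 @ -1/5)` — replaces the a-priori `2H_b(1/4/2)`. [cite: Ruelle1969, §3.4] [cite: Israel1979, Thm. I.3.4] -/
theorem lsco_freeDiluteCap_1o4_right {s₁ s₂ U₁ U₂ : ℝ} (hs₁ : -1 / 4 ≤ s₁) (hs₂ : s₂ ≤ -1 / 5) (hU₁ : 0 ≤ U₁) :
    ∀ s ∈ Icc s₁ s₂, ∀ U ∈ Icc U₁ U₂, pressureTT' (8 : ℝ) 1 s U (1 / 4 : ℝ) ≤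
      ((-1 / 5 - s) * ((205801 / 250000 : ℝ) - 8 * (-559 / 250) * (1 / 4)) + (s - (-1 / 4)) * ((469413 / 500000 : ℝ) - 8 * (-288 / 125) * (1 / 4))) /
        (-1 / 5 - (-1 / 4)) := by
  have hA := freeGCPressureTT'_b8_tpm1o4_n1o4_le
  have hB := freeGCPressureTT'_b8_tpm1o5_n1o4_le
  push_cast at hA hB
  exact pressureTT'_le_schord_of_freeGCPressureTT' (βh := 8) (by norm_num) (n := 1 / 4) (by norm_num) (by norm_num)
    (sa := -1 / 4) (sb := -1 / 5) (by norm_num) hA hB hs₁ hs₂ hU₁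

/-! ## §1 `(≤ 1/5 | ≥ 1)` on `t′ ∈ [−1/4, −1/5]` -/

/-- **`(≤ 1/5 | ≥ 1)` EXCLUDED on `t′ ∈ [−1/4, −1/5] × U ∈ [8, 81/10]`, every `β ≥ 10`** (`β₀ = 9.63`; g24 `β ≥ 12`; dilute bracket `0.033 / 0.026` at the `s`-ends): for every `(s, U)` of the sub-cell and every canonical thermal torus-limit state of the `t–t′` model at `(β; 1, s, U; n)` (any `0 < n < 2`), the state is NOT a macroscopic mixture of a translation-invariant phase of density `0 < ρ(ω₁) ≤ 1/5` and one of density `1 ≤ ρ(ω₂) < 2`. [cite: Israel1979, Thm. I.2.4] [cite: EmeryKivelsonLin1990, pp. 475–476] [cite: PoulinHastings2011, eqs. (3)–(8)] [cite: Griffiths1966, §II] [cite: Ruelle1969, §3.4] -/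
theorem lsco78_psTF_1o5_right_above81o10_beta10 (hVB : cert_obx32x4tpm1o4D1200_openbox_32x4_N112_planes)
    (hK8 : cert_laBoxE_K2diag_GU8n1tpm3o10_j299783_up)
    (h472 : cert_r472_pb2_tl_upper_n1_U8) (h428 : cert_r428_hubSQ_hanK7R6_U8_r5_e4_so4blk)
    (hC1 : cert_feC1tt_stair221_tpm1o4_b2_j300793)
    {s : ℝ} (hs : s ∈ Icc (-1 / 4 : ℝ) (-1 / 5)) {U : ℝ} (hU : U ∈ Icc (8 : ℝ) (81 / 10))
    {β : ℝ} (hβ : (10 : ℝ) ≤ β)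
    {ω₁ ω₂ : InfVolFermionState 2} (h₁ : ω₁.IsTranslationInvariant) (h₂ : ω₂.IsTranslationInvariant)
    (hρ₁ : 0 < ω₁.density) (hρ₁' : ω₁.density ≤ 1 / 5) (hρ₂ : 1 ≤ ω₂.density) (hρ₂' : ω₂.density < 2)
    {n : ℝ} (hn0 : 0 < n) (hn2 : n < 2) {lam : ℝ} (hl0 : 0 < lam) (hl1 : lam < 1) {Ls : ℕ → ℕ}
    (hLs : Tendsto Ls atTop atTop) :
    ¬ (mix lam hl0.le hl1.le ω₁ ω₂).IsTorusLimitOfMixture (sectorGibbsCount n) (fun L => sectorGibbsWeightTT' β 1 s U n L)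
      (fun L => sectorGibbsVectorTT' 1 s U n L) Ls := by
  refine psT_not_thermal_mix_above_column_hotAnchorSS 1 (s₁ := -1 / 4) (s₂ := -1 / 5) (U₂ := 8) (U₃ := 81 / 10)
    (n₁ := 1 / 5) (n₂ := 1) (a := 5 / 32) (b := 27 / 32) (β₀ := 10) (βh₁ := 8) (βh₂ := 2)
    (by norm_num) (by norm_num) (by norm_num) (by norm_num) (by norm_num) (by norm_num) (by norm_num) (by norm_num)
    (by norm_num) (by norm_num) (by norm_num) (by norm_num) hβ (by norm_num)
    (lsco78_capPlane_on_cell_of hVB (by norm_num) (by norm_num) (by norm_num))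
    (fun s hs => lsco_n1_law8_of hK8 h472 h428 s ⟨hs.1.trans' (by norm_num), hs.2.trans (by norm_num)⟩)
    (fun s hs U hU => lsco_dilute14_floor_right (n₁ := 1 / 5) (by norm_num) (by norm_num) s hs U (by linarith [hU.1]))
    (lsco_freeDiluteCap_1o5_right (by norm_num) (by norm_num) (by norm_num))
    (lsco_hotCap_n1_b2_j300793_on_cell hC1 (by norm_num) (by norm_num) (by norm_num))
    ?_ ?_ hs hU h₁ h₂ hρ₁ hρ₁' hρ₂ hρ₂' hn0 hn2 hl0 hl1 hLs
  · intro s hs; obtain ⟨h1, h2⟩ := hs; push_cast; norm_num; nlinarith [h1, h2]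
  · intro s hs; obtain ⟨h1, h2⟩ := hs; push_cast; norm_num; nlinarith [h1, h2]

/-- **`(≤ 1/5 | ≥ 1)` on `t′ ∈ [−1/4, −1/5] × U ∈ [8, 83/10]`, every `β ≥ 12`** (`β₀ = 11.39`; g24 `14`). [cite: Israel1979, Thm. I.2.4] [cite: EmeryKivelsonLin1990, pp. 475–476] [cite: PoulinHastings2011, eqs. (3)–(8)] [cite: Griffiths1966, §II] [cite: Ruelle1969, §3.4] -/
theorem lsco78_psTF_1o5_right_above83o10_beta12 (hVB : cert_obx32x4tpm1o4D1200_openbox_32x4_N112_planes)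
    (hK8 : cert_laBoxE_K2diag_GU8n1tpm3o10_j299783_up)
    (h472 : cert_r472_pb2_tl_upper_n1_U8) (h428 : cert_r428_hubSQ_hanK7R6_U8_r5_e4_so4blk)
    (hC1 : cert_feC1tt_stair221_tpm1o4_b2_j300793)
    {s : ℝ} (hs : s ∈ Icc (-1 / 4 : ℝ) (-1 / 5)) {U : ℝ} (hU : U ∈ Icc (8 : ℝ) (83 / 10))
    {β : ℝ} (hβ : (12 : ℝ) ≤ β)
    {ω₁ ω₂ : InfVolFermionState 2} (h₁ : ω₁.IsTranslationInvariant) (h₂ : ω₂.IsTranslationInvariant)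
    (hρ₁ : 0 < ω₁.density) (hρ₁' : ω₁.density ≤ 1 / 5) (hρ₂ : 1 ≤ ω₂.density) (hρ₂' : ω₂.density < 2)
    {n : ℝ} (hn0 : 0 < n) (hn2 : n < 2) {lam : ℝ} (hl0 : 0 < lam) (hl1 : lam < 1) {Ls : ℕ → ℕ}
    (hLs : Tendsto Ls atTop atTop) :
    ¬ (mix lam hl0.le hl1.le ω₁ ω₂).IsTorusLimitOfMixture (sectorGibbsCount n) (fun L => sectorGibbsWeightTT' β 1 s U n L)
      (fun L => sectorGibbsVectorTT' 1 s U n L) Ls := by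
  refine psT_not_thermal_mix_above_column_hotAnchorSS 1 (s₁ := -1 / 4) (s₂ := -1 / 5) (U₂ := 8) (U₃ := 83 / 10)
    (n₁ := 1 / 5) (n₂ := 1) (a := 5 / 32) (b := 27 / 32) (β₀ := 12) (βh₁ := 8) (βh₂ := 2)
    (by norm_num) (by norm_num) (by norm_num) (by norm_num) (by norm_num) (by norm_num) (by norm_num) (by norm_num)
    (by norm_num) (by norm_num) (by norm_num) (by norm_num) hβ (by norm_num)
    (lsco78_capPlane_on_cell_of hVB (by norm_num) (by norm_num) (by norm_num))
    (fun s hs => lsco_n1_law8_of hK8 h472 h428 s ⟨hs.1.trans' (by norm_num), hs.2.trans (by norm_num)⟩)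
    (fun s hs U hU => lsco_dilute14_floor_right (n₁ := 1 / 5) (by norm_num) (by norm_num) s hs U (by linarith [hU.1]))
    (lsco_freeDiluteCap_1o5_right (by norm_num) (by norm_num) (by norm_num))
    (lsco_hotCap_n1_b2_j300793_on_cell hC1 (by norm_num) (by norm_num) (by norm_num))
    ?_ ?_ hs hU h₁ h₂ hρ₁ hρ₁' hρ₂ hρ₂' hn0 hn2 hl0 hl1 hLs
  · intro s hs; obtain ⟨h1, h2⟩ := hs; push_cast; norm_num; nlinarith [h1, h2]
  · intro s hs; obtain ⟨h1, h2⟩ := hs; push_cast; norm_num; nlinarith [h1, h2]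

/-- **`(≤ 1/5 | ≥ 1)` on `t′ ∈ [−1/4, −1/5] × U ∈ [8, 43/5]`, every `β ≥ 16`** (`β₀ = 15.70`; far-end `T = 0` margin `0.0272`). [cite: Israel1979, Thm. I.2.4] [cite: EmeryKivelsonLin1990, pp. 475–476] [cite: PoulinHastings2011, eqs. (3)–(8)] [cite: Griffiths1966, §II] [cite: Ruelle1969, §3.4] -/
theorem lsco78_psTF_1o5_right_above43o5_beta16 (hVB : cert_obx32x4tpm1o4D1200_openbox_32x4_N112_planes)
    (hK8 : cert_laBoxE_K2diag_GU8n1tpm3o10_j299783_up)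
    (h472 : cert_r472_pb2_tl_upper_n1_U8) (h428 : cert_r428_hubSQ_hanK7R6_U8_r5_e4_so4blk)
    (hC1 : cert_feC1tt_stair221_tpm1o4_b2_j300793)
    {s : ℝ} (hs : s ∈ Icc (-1 / 4 : ℝ) (-1 / 5)) {U : ℝ} (hU : U ∈ Icc (8 : ℝ) (43 / 5))
    {β : ℝ} (hβ : (16 : ℝ) ≤ β)
    {ω₁ ω₂ : InfVolFermionState 2} (h₁ : ω₁.IsTranslationInvariant) (h₂ : ω₂.IsTranslationInvariant)
    (hρ₁ : 0 < ω₁.density) (hρ₁' : ω₁.density ≤ 1 / 5) (hρ₂ : 1 ≤ ω₂.density) (hρ₂' : ω₂.density < 2)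
    {n : ℝ} (hn0 : 0 < n) (hn2 : n < 2) {lam : ℝ} (hl0 : 0 < lam) (hl1 : lam < 1) {Ls : ℕ → ℕ}
    (hLs : Tendsto Ls atTop atTop) :
    ¬ (mix lam hl0.le hl1.le ω₁ ω₂).IsTorusLimitOfMixture (sectorGibbsCount n) (fun L => sectorGibbsWeightTT' β 1 s U n L)
      (fun L => sectorGibbsVectorTT' 1 s U n L) Ls := by
  refine psT_not_thermal_mix_above_column_hotAnchorSS 1 (s₁ := -1 / 4) (s₂ := -1 / 5) (U₂ := 8) (U₃ := 43 / 5)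
    (n₁ := 1 / 5) (n₂ := 1) (a := 5 / 32) (b := 27 / 32) (β₀ := 16) (βh₁ := 8) (βh₂ := 2)
    (by norm_num) (by norm_num) (by norm_num) (by norm_num) (by norm_num) (by norm_num) (by norm_num) (by norm_num)
    (by norm_num) (by norm_num) (by norm_num) (by norm_num) hβ (by norm_num)
    (lsco78_capPlane_on_cell_of hVB (by norm_num) (by norm_num) (by norm_num))
    (fun s hs => lsco_n1_law8_of hK8 h472 h428 s ⟨hs.1.trans' (by norm_num), hs.2.trans (by norm_num)⟩)
    (fun s hs U hU => lsco_dilute14_floor_right (n₁ := 1 / 5) (by norm_num) (by norm_num) s hs U (by linarith [hU.1]))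
    (lsco_freeDiluteCap_1o5_right (by norm_num) (by norm_num) (by norm_num))
    (lsco_hotCap_n1_b2_j300793_on_cell hC1 (by norm_num) (by norm_num) (by norm_num))
    ?_ ?_ hs hU h₁ h₂ hρ₁ hρ₁' hρ₂ hρ₂' hn0 hn2 hl0 hl1 hLs
  · intro s hs; obtain ⟨h1, h2⟩ := hs; push_cast; norm_num; nlinarith [h1, h2]
  · intro s hs; obtain ⟨h1, h2⟩ := hs; push_cast; norm_num; nlinarith [h1, h2]

/-- **`(≤ 1/5 | ≥ 1)` on the columns `t′ ∈ [−1/4, −1/5] × U ∈ [79/10, 8]`, every `β ≥ 15`** (`β₀ = 14.39`; `n₂`-anchor j290715 `β_h = 3/4` on the band `|t′| ≤ 5/16 × U ≥ 15/2`; `n = 1` laws at `79/10` (chord) and `8`). [cite: Israel1979, Thm. I.2.4] [cite: EmeryKivelsonLin1990, pp. 475–476] [cite: PoulinHastings2011, eqs. (3)–(8)] [cite: Griffiths1966, §II] [cite: Ruelle1969, §3.4] -/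
theorem lsco78_psTF_1o5_right_columns79o10_beta15 (hVB : cert_obx32x4tpm1o4D1200_openbox_32x4_N112_planes)
    (hK29 : cert_laBoxE_K2diag_GU29o5n1tpm3o10_j295889_up) (hK8 : cert_laBoxE_K2diag_GU8n1tpm3o10_j299783_up)
    (h21 : cert_r21_luc_tl_upper_n1_U6) (h487 : cert_r487_hubSQ_hanK7R6_U10_r5_e4_so4blk)
    (h427 : cert_r427_hubSQ_hanK7_U5_r5_e4_so4blk) (h488 : cert_r488_hubSQ_hanK7R6_U6_r5_e4_so4blk)
    (h472 : cert_r472_pb2_tl_upper_n1_U8) (h428 : cert_r428_hubSQ_hanK7R6_U8_r5_e4_so4blk)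
    (hLL : cert_feC1tt_3x2_tpm5o16_U15o2_b3o4_j290715)
    {s : ℝ} (hs : s ∈ Icc (-1 / 4 : ℝ) (-1 / 5)) {U : ℝ} (hU : U ∈ Icc (79 / 10 : ℝ) 8)
    {β : ℝ} (hβ : (15 : ℝ) ≤ β)
    {ω₁ ω₂ : InfVolFermionState 2} (h₁ : ω₁.IsTranslationInvariant) (h₂ : ω₂.IsTranslationInvariant)
    (hρ₁ : 0 < ω₁.density) (hρ₁' : ω₁.density ≤ 1 / 5) (hρ₂ : 1 ≤ ω₂.density) (hρ₂' : ω₂.density < 2)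
    {n : ℝ} (hn0 : 0 < n) (hn2 : n < 2) {lam : ℝ} (hl0 : 0 < lam) (hl1 : lam < 1) {Ls : ℕ → ℕ}
    (hLs : Tendsto Ls atTop atTop) :
    ¬ (mix lam hl0.le hl1.le ω₁ ω₂).IsTorusLimitOfMixture (sectorGibbsCount n) (fun L => sectorGibbsWeightTT' β 1 s U n L)
      (fun L => sectorGibbsVectorTT' 1 s U n L) Ls := by
  refine psT_not_thermal_mix_on_cell_of_columns_hotAnchorSS 1 (s₁ := -1 / 4) (s₂ := -1 / 5) (U₁ := 79 / 10) (U₂ := 8)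
    (n₁ := 1 / 5) (n₂ := 1) (a := 5 / 32) (b := 27 / 32) (β₀ := 15) (βh₁ := 8) (βh₂ := 3 / 4)
    (by norm_num) (by norm_num) (by norm_num) (by norm_num) (by norm_num) (by norm_num) (by norm_num) (by norm_num)
    (by norm_num) (by norm_num) (by norm_num) (by norm_num) hβ (by norm_num)
    (lsco78_capPlane_on_cell_of hVB (by norm_num) (by norm_num) (by norm_num))
    (fun s hs => lsco_n1_lawAt_of hK29 hK8 h21 h487 h427 h488 h472 h428 (U₀ := 79 / 10) (by norm_num) s
      ⟨hs.1.trans' (by norm_num), hs.2.trans (by norm_num)⟩)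
    (fun s hs => lsco_n1_law8_of hK8 h472 h428 s ⟨hs.1.trans' (by norm_num), hs.2.trans (by norm_num)⟩)
    (fun s hs U hU => lsco_dilute14_floor_right (n₁ := 1 / 5) (by norm_num) (by norm_num) s hs U (by linarith [hU.1]))
    (lsco_freeDiluteCap_1o5_right (by norm_num) (by norm_num) (by norm_num))
    (lsco_hotCap_n1_b3o4_j290715_on_band hLL (by norm_num) (by norm_num) (by norm_num))
    ?_ ?_ ?_ ?_ hs hU h₁ h₂ hρ₁ hρ₁' hρ₂ hρ₂' hn0 hn2 hl0 hl1 hLs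
  · intro s hs; obtain ⟨h1, h2⟩ := hs; push_cast; norm_num; nlinarith [h1, h2]
  · intro s hs; obtain ⟨h1, h2⟩ := hs; push_cast; norm_num; nlinarith [h1, h2]
  · intro s hs; obtain ⟨h1, h2⟩ := hs; push_cast; norm_num; nlinarith [h1, h2]
  · intro s hs; obtain ⟨h1, h2⟩ := hs; push_cast; norm_num; nlinarith [h1, h2]

/-- **`(≤ 1/5 | ≥ 1)` on the columns `t′ ∈ [−1/4, −1/5] × U ∈ [38/5, 8]`, every `β ≥ 20`** (`β₀ = 19.90`; g20's binding corner of the wide cell). [cite: Israel1979, Thm. I.2.4] [cite: EmeryKivelsonLin1990, pp. 475–476] [cite: PoulinHastings2011, eqs. (3)–(8)] [cite: Griffiths1966, §II] [cite: Ruelle1969, §3.4] -/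
theorem lsco78_psTF_1o5_right_columns38o5_beta20 (hVB : cert_obx32x4tpm1o4D1200_openbox_32x4_N112_planes)
    (hK29 : cert_laBoxE_K2diag_GU29o5n1tpm3o10_j295889_up) (hK8 : cert_laBoxE_K2diag_GU8n1tpm3o10_j299783_up)
    (h21 : cert_r21_luc_tl_upper_n1_U6) (h487 : cert_r487_hubSQ_hanK7R6_U10_r5_e4_so4blk)
    (h427 : cert_r427_hubSQ_hanK7_U5_r5_e4_so4blk) (h488 : cert_r488_hubSQ_hanK7R6_U6_r5_e4_so4blk)
    (h472 : cert_r472_pb2_tl_upper_n1_U8) (h428 : cert_r428_hubSQ_hanK7R6_U8_r5_e4_so4blk)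
    (hLL : cert_feC1tt_3x2_tpm5o16_U15o2_b3o4_j290715)
    {s : ℝ} (hs : s ∈ Icc (-1 / 4 : ℝ) (-1 / 5)) {U : ℝ} (hU : U ∈ Icc (38 / 5 : ℝ) 8)
    {β : ℝ} (hβ : (20 : ℝ) ≤ β)
    {ω₁ ω₂ : InfVolFermionState 2} (h₁ : ω₁.IsTranslationInvariant) (h₂ : ω₂.IsTranslationInvariant)
    (hρ₁ : 0 < ω₁.density) (hρ₁' : ω₁.density ≤ 1 / 5) (hρ₂ : 1 ≤ ω₂.density) (hρ₂' : ω₂.density < 2)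
    {n : ℝ} (hn0 : 0 < n) (hn2 : n < 2) {lam : ℝ} (hl0 : 0 < lam) (hl1 : lam < 1) {Ls : ℕ → ℕ}
    (hLs : Tendsto Ls atTop atTop) :
    ¬ (mix lam hl0.le hl1.le ω₁ ω₂).IsTorusLimitOfMixture (sectorGibbsCount n) (fun L => sectorGibbsWeightTT' β 1 s U n L)
      (fun L => sectorGibbsVectorTT' 1 s U n L) Ls := by
  refine psT_not_thermal_mix_on_cell_of_columns_hotAnchorSS 1 (s₁ := -1 / 4) (s₂ := -1 / 5) (U₁ := 38 / 5) (U₂ := 8)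
    (n₁ := 1 / 5) (n₂ := 1) (a := 5 / 32) (b := 27 / 32) (β₀ := 20) (βh₁ := 8) (βh₂ := 3 / 4)
    (by norm_num) (by norm_num) (by norm_num) (by norm_num) (by norm_num) (by norm_num) (by norm_num) (by norm_num)
    (by norm_num) (by norm_num) (by norm_num) (by norm_num) hβ (by norm_num)
    (lsco78_capPlane_on_cell_of hVB (by norm_num) (by norm_num) (by norm_num))
    (fun s hs => lsco_n1_lawAt_of hK29 hK8 h21 h487 h427 h488 h472 h428 (U₀ := 38 / 5) (by norm_num) s
      ⟨hs.1.trans' (by norm_num), hs.2.trans (by norm_num)⟩)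
    (fun s hs => lsco_n1_law8_of hK8 h472 h428 s ⟨hs.1.trans' (by norm_num), hs.2.trans (by norm_num)⟩)
    (fun s hs U hU => lsco_dilute14_floor_right (n₁ := 1 / 5) (by norm_num) (by norm_num) s hs U (by linarith [hU.1]))
    (lsco_freeDiluteCap_1o5_right (by norm_num) (by norm_num) (by norm_num))
    (lsco_hotCap_n1_b3o4_j290715_on_band hLL (by norm_num) (by norm_num) (by norm_num))
    ?_ ?_ ?_ ?_ hs hU h₁ h₂ hρ₁ hρ₁' hρ₂ hρ₂' hn0 hn2 hl0 hl1 hLs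
  · intro s hs; obtain ⟨h1, h2⟩ := hs; push_cast; norm_num; nlinarith [h1, h2]
  · intro s hs; obtain ⟨h1, h2⟩ := hs; push_cast; norm_num; nlinarith [h1, h2]
  · intro s hs; obtain ⟨h1, h2⟩ := hs; push_cast; norm_num; nlinarith [h1, h2]
  · intro s hs; obtain ⟨h1, h2⟩ := hs; push_cast; norm_num; nlinarith [h1, h2]

/-- **`(≤ 1/5 | ≥ 1)` on `t′ ∈ [−1/4, −1/5] × U ∈ [79/10, 81/10]`, every `β ≥ 15`** (columns `β ≥ 15` ∣ above `β ≥ 10`) — `T ≲ 263–309 K`. [cite: Israel1979, Thm. I.2.4] [cite: EmeryKivelsonLin1990, pp. 475–476] [cite: PoulinHastings2011, eqs. (3)–(8)] [cite: Griffiths1966, §II] [cite: Ruelle1969, §3.4] -/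
theorem lsco78_not_thermal_mix_le_1o5_ge_one_beta15_right_freeDilute (hVB : cert_obx32x4tpm1o4D1200_openbox_32x4_N112_planes)
    (hK29 : cert_laBoxE_K2diag_GU29o5n1tpm3o10_j295889_up) (hK8 : cert_laBoxE_K2diag_GU8n1tpm3o10_j299783_up)
    (h21 : cert_r21_luc_tl_upper_n1_U6) (h487 : cert_r487_hubSQ_hanK7R6_U10_r5_e4_so4blk)
    (h427 : cert_r427_hubSQ_hanK7_U5_r5_e4_so4blk) (h488 : cert_r488_hubSQ_hanK7R6_U6_r5_e4_so4blk)
    (h472 : cert_r472_pb2_tl_upper_n1_U8) (h428 : cert_r428_hubSQ_hanK7R6_U8_r5_e4_so4blk)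
    (hLL : cert_feC1tt_3x2_tpm5o16_U15o2_b3o4_j290715) (hC1 : cert_feC1tt_stair221_tpm1o4_b2_j300793)
    {s : ℝ} (hs : s ∈ Icc (-1 / 4 : ℝ) (-1 / 5)) {U : ℝ} (hU : U ∈ Icc (79 / 10 : ℝ) (81 / 10))
    {β : ℝ} (hβ : (15 : ℝ) ≤ β)
    {ω₁ ω₂ : InfVolFermionState 2} (h₁ : ω₁.IsTranslationInvariant) (h₂ : ω₂.IsTranslationInvariant)
    (hρ₁ : 0 < ω₁.density) (hρ₁' : ω₁.density ≤ 1 / 5) (hρ₂ : 1 ≤ ω₂.density) (hρ₂' : ω₂.density < 2)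
    {n : ℝ} (hn0 : 0 < n) (hn2 : n < 2) {lam : ℝ} (hl0 : 0 < lam) (hl1 : lam < 1) {Ls : ℕ → ℕ}
    (hLs : Tendsto Ls atTop atTop) :
    ¬ (mix lam hl0.le hl1.le ω₁ ω₂).IsTorusLimitOfMixture (sectorGibbsCount n) (fun L => sectorGibbsWeightTT' β 1 s U n L)
      (fun L => sectorGibbsVectorTT' 1 s U n L) Ls := by
  rcases le_total U 8 with hUl | hUr
  · exact lsco78_psTF_1o5_right_columns79o10_beta15 hVB hK29 hK8 h21 h487 h427 h488 h472 h428 hLL hs ⟨hU.1, hUl⟩ (hβ.trans' (by norm_num)) h₁ h₂ hρ₁ hρ₁' hρ₂ hρ₂' hn0 hn2 hl0 hl1 hLs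
  · exact lsco78_psTF_1o5_right_above81o10_beta10 hVB hK8 h472 h428 hC1 hs ⟨hUr, hU.2⟩ (hβ.trans' (by norm_num)) h₁ h₂ hρ₁ hρ₁' hρ₂ hρ₂' hn0 hn2 hl0 hl1 hLs

/-- **`(≤ 1/5 | ≥ 1)` on the WIDE right cell `t′ ∈ [−1/4, −1/5] × U ∈ [38/5, 43/5]`, every `β ≥ 20`** (columns `[38/5, 8]` `β ≥ 20` ∣ above `[8, 43/5]` `β ≥ 16`; g24: `24`) — `T ≲ 197–232 K`. [cite: Israel1979, Thm. I.2.4] [cite: EmeryKivelsonLin1990, pp. 475–476] [cite: PoulinHastings2011, eqs. (3)–(8)] [cite: Griffiths1966, §II] [cite: Ruelle1969, §3.4] -/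
theorem lsco78_not_thermal_mix_le_1o5_ge_one_beta20_rightWide_freeDilute (hVB : cert_obx32x4tpm1o4D1200_openbox_32x4_N112_planes)
    (hK29 : cert_laBoxE_K2diag_GU29o5n1tpm3o10_j295889_up) (hK8 : cert_laBoxE_K2diag_GU8n1tpm3o10_j299783_up)
    (h21 : cert_r21_luc_tl_upper_n1_U6) (h487 : cert_r487_hubSQ_hanK7R6_U10_r5_e4_so4blk)
    (h427 : cert_r427_hubSQ_hanK7_U5_r5_e4_so4blk) (h488 : cert_r488_hubSQ_hanK7R6_U6_r5_e4_so4blk)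
    (h472 : cert_r472_pb2_tl_upper_n1_U8) (h428 : cert_r428_hubSQ_hanK7R6_U8_r5_e4_so4blk)
    (hLL : cert_feC1tt_3x2_tpm5o16_U15o2_b3o4_j290715) (hC1 : cert_feC1tt_stair221_tpm1o4_b2_j300793)
    {s : ℝ} (hs : s ∈ Icc (-1 / 4 : ℝ) (-1 / 5)) {U : ℝ} (hU : U ∈ Icc (38 / 5 : ℝ) (43 / 5))
    {β : ℝ} (hβ : (20 : ℝ) ≤ β)
    {ω₁ ω₂ : InfVolFermionState 2} (h₁ : ω₁.IsTranslationInvariant) (h₂ : ω₂.IsTranslationInvariant)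
    (hρ₁ : 0 < ω₁.density) (hρ₁' : ω₁.density ≤ 1 / 5) (hρ₂ : 1 ≤ ω₂.density) (hρ₂' : ω₂.density < 2)
    {n : ℝ} (hn0 : 0 < n) (hn2 : n < 2) {lam : ℝ} (hl0 : 0 < lam) (hl1 : lam < 1) {Ls : ℕ → ℕ}
    (hLs : Tendsto Ls atTop atTop) :
    ¬ (mix lam hl0.le hl1.le ω₁ ω₂).IsTorusLimitOfMixture (sectorGibbsCount n) (fun L => sectorGibbsWeightTT' β 1 s U n L)
      (fun L => sectorGibbsVectorTT' 1 s U n L) Ls := by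
  rcases le_total U 8 with hUl | hUr
  · exact lsco78_psTF_1o5_right_columns38o5_beta20 hVB hK29 hK8 h21 h487 h427 h488 h472 h428 hLL hs ⟨hU.1, hUl⟩ (hβ.trans' (by norm_num)) h₁ h₂ hρ₁ hρ₁' hρ₂ hρ₂' hn0 hn2 hl0 hl1 hLs
  · exact lsco78_psTF_1o5_right_above43o5_beta16 hVB hK8 h472 h428 hC1 hs ⟨hUr, hU.2⟩ (hβ.trans' (by norm_num)) h₁ h₂ hρ₁ hρ₁' hρ₂ hρ₂' hn0 hn2 hl0 hl1 hLs

/-! ## §2 `(≤ 1/4 | ≥ 1)` on `t′ ∈ [−1/4, −1/5]` -/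

/-- **`(≤ 1/4 | ≥ 1)` EXCLUDED on `t′ ∈ [−1/4, −1/5] × U ∈ [8, 81/10]`, every `β ≥ 16`** (`β₀ = 15.87`; g24 `β ≥ 21`; dilute bracket `0.067 / 0.057`): no canonical thermal torus-limit state at `(β; 1, s, U; n)` is a macroscopic mixture of translation-invariant phases of densities `0 < ρ(ω₁) ≤ 1/4` and `1 ≤ ρ(ω₂) < 2`. [cite: Israel1979, Thm. I.2.4] [cite: EmeryKivelsonLin1990, pp. 475–476] [cite: PoulinHastings2011, eqs. (3)–(8)] [cite: Griffiths1966, §II] [cite: Ruelle1969, §3.4] -/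
theorem lsco78_psTF_1o4_right_above81o10_beta16 (hVB : cert_obx32x4tpm1o4D1200_openbox_32x4_N112_planes)
    (hK8 : cert_laBoxE_K2diag_GU8n1tpm3o10_j299783_up)
    (h472 : cert_r472_pb2_tl_upper_n1_U8) (h428 : cert_r428_hubSQ_hanK7R6_U8_r5_e4_so4blk)
    (hC1 : cert_feC1tt_stair221_tpm1o4_b2_j300793)
    {s : ℝ} (hs : s ∈ Icc (-1 / 4 : ℝ) (-1 / 5)) {U : ℝ} (hU : U ∈ Icc (8 : ℝ) (81 / 10))
    {β : ℝ} (hβ : (16 : ℝ) ≤ β)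
    {ω₁ ω₂ : InfVolFermionState 2} (h₁ : ω₁.IsTranslationInvariant) (h₂ : ω₂.IsTranslationInvariant)
    (hρ₁ : 0 < ω₁.density) (hρ₁' : ω₁.density ≤ 1 / 4) (hρ₂ : 1 ≤ ω₂.density) (hρ₂' : ω₂.density < 2)
    {n : ℝ} (hn0 : 0 < n) (hn2 : n < 2) {lam : ℝ} (hl0 : 0 < lam) (hl1 : lam < 1) {Ls : ℕ → ℕ}
    (hLs : Tendsto Ls atTop atTop) :
    ¬ (mix lam hl0.le hl1.le ω₁ ω₂).IsTorusLimitOfMixture (sectorGibbsCount n) (fun L => sectorGibbsWeightTT' β 1 s U n L)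
      (fun L => sectorGibbsVectorTT' 1 s U n L) Ls := by
  refine psT_not_thermal_mix_above_column_hotAnchorSS 1 (s₁ := -1 / 4) (s₂ := -1 / 5) (U₂ := 8) (U₃ := 81 / 10)
    (n₁ := 1 / 4) (n₂ := 1) (a := 1 / 6) (b := 5 / 6) (β₀ := 16) (βh₁ := 8) (βh₂ := 2)
    (by norm_num) (by norm_num) (by norm_num) (by norm_num) (by norm_num) (by norm_num) (by norm_num) (by norm_num)
    (by norm_num) (by norm_num) (by norm_num) (by norm_num) hβ (by norm_num)
    (lsco78_capPlane_on_cell_of hVB (by norm_num) (by norm_num) (by norm_num))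
    (fun s hs => lsco_n1_law8_of hK8 h472 h428 s ⟨hs.1.trans' (by norm_num), hs.2.trans (by norm_num)⟩)
    (fun s hs U hU => lsco_dilute14_floor_right (n₁ := 1 / 4) (by norm_num) (by norm_num) s hs U (by linarith [hU.1]))
    (lsco_freeDiluteCap_1o4_right (by norm_num) (by norm_num) (by norm_num))
    (lsco_hotCap_n1_b2_j300793_on_cell hC1 (by norm_num) (by norm_num) (by norm_num))
    ?_ ?_ hs hU h₁ h₂ hρ₁ hρ₁' hρ₂ hρ₂' hn0 hn2 hl0 hl1 hLs
  · intro s hs; obtain ⟨h1, h2⟩ := hs; push_cast; norm_num; nlinarith [h1, h2]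
  · intro s hs; obtain ⟨h1, h2⟩ := hs; push_cast; norm_num; nlinarith [h1, h2]

/-- **`(≤ 1/4 | ≥ 1)` on `t′ ∈ [−1/4, −1/5] × U ∈ [8, 83/10]`, every `β ≥ 22`** (`β₀ = 21.29`). [cite: Israel1979, Thm. I.2.4] [cite: EmeryKivelsonLin1990, pp. 475–476] [cite: PoulinHastings2011, eqs. (3)–(8)] [cite: Griffiths1966, §II] [cite: Ruelle1969, §3.4] -/
theorem lsco78_psTF_1o4_right_above83o10_beta22 (hVB : cert_obx32x4tpm1o4D1200_openbox_32x4_N112_planes)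
    (hK8 : cert_laBoxE_K2diag_GU8n1tpm3o10_j299783_up)
    (h472 : cert_r472_pb2_tl_upper_n1_U8) (h428 : cert_r428_hubSQ_hanK7R6_U8_r5_e4_so4blk)
    (hC1 : cert_feC1tt_stair221_tpm1o4_b2_j300793)
    {s : ℝ} (hs : s ∈ Icc (-1 / 4 : ℝ) (-1 / 5)) {U : ℝ} (hU : U ∈ Icc (8 : ℝ) (83 / 10))
    {β : ℝ} (hβ : (22 : ℝ) ≤ β)
    {ω₁ ω₂ : InfVolFermionState 2} (h₁ : ω₁.IsTranslationInvariant) (h₂ : ω₂.IsTranslationInvariant)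
    (hρ₁ : 0 < ω₁.density) (hρ₁' : ω₁.density ≤ 1 / 4) (hρ₂ : 1 ≤ ω₂.density) (hρ₂' : ω₂.density < 2)
    {n : ℝ} (hn0 : 0 < n) (hn2 : n < 2) {lam : ℝ} (hl0 : 0 < lam) (hl1 : lam < 1) {Ls : ℕ → ℕ}
    (hLs : Tendsto Ls atTop atTop) :
    ¬ (mix lam hl0.le hl1.le ω₁ ω₂).IsTorusLimitOfMixture (sectorGibbsCount n) (fun L => sectorGibbsWeightTT' β 1 s U n L)
      (fun L => sectorGibbsVectorTT' 1 s U n L) Ls := by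
  refine psT_not_thermal_mix_above_column_hotAnchorSS 1 (s₁ := -1 / 4) (s₂ := -1 / 5) (U₂ := 8) (U₃ := 83 / 10)
    (n₁ := 1 / 4) (n₂ := 1) (a := 1 / 6) (b := 5 / 6) (β₀ := 22) (βh₁ := 8) (βh₂ := 2)
    (by norm_num) (by norm_num) (by norm_num) (by norm_num) (by norm_num) (by norm_num) (by norm_num) (by norm_num)
    (by norm_num) (by norm_num) (by norm_num) (by norm_num) hβ (by norm_num)
    (lsco78_capPlane_on_cell_of hVB (by norm_num) (by norm_num) (by norm_num))
    (fun s hs => lsco_n1_law8_of hK8 h472 h428 s ⟨hs.1.trans' (by norm_num), hs.2.trans (by norm_num)⟩)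
    (fun s hs U hU => lsco_dilute14_floor_right (n₁ := 1 / 4) (by norm_num) (by norm_num) s hs U (by linarith [hU.1]))
    (lsco_freeDiluteCap_1o4_right (by norm_num) (by norm_num) (by norm_num))
    (lsco_hotCap_n1_b2_j300793_on_cell hC1 (by norm_num) (by norm_num) (by norm_num))
    ?_ ?_ hs hU h₁ h₂ hρ₁ hρ₁' hρ₂ hρ₂' hn0 hn2 hl0 hl1 hLs
  · intro s hs; obtain ⟨h1, h2⟩ := hs; push_cast; norm_num; nlinarith [h1, h2]
  · intro s hs; obtain ⟨h1, h2⟩ := hs; push_cast; norm_num; nlinarith [h1, h2]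

/-- **`(≤ 1/4 | ≥ 1)` on the columns `t′ ∈ [−1/4, −1/5] × U ∈ [79/10, 8]`, every `β ≥ 24`** (`β₀ = 23.84`; j290715 `n₂`-anchor). [cite: Israel1979, Thm. I.2.4] [cite: EmeryKivelsonLin1990, pp. 475–476] [cite: PoulinHastings2011, eqs. (3)–(8)] [cite: Griffiths1966, §II] [cite: Ruelle1969, §3.4] -/
theorem lsco78_psTF_1o4_right_columns79o10_beta24 (hVB : cert_obx32x4tpm1o4D1200_openbox_32x4_N112_planes)
    (hK29 : cert_laBoxE_K2diag_GU29o5n1tpm3o10_j295889_up) (hK8 : cert_laBoxE_K2diag_GU8n1tpm3o10_j299783_up)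
    (h21 : cert_r21_luc_tl_upper_n1_U6) (h487 : cert_r487_hubSQ_hanK7R6_U10_r5_e4_so4blk)
    (h427 : cert_r427_hubSQ_hanK7_U5_r5_e4_so4blk) (h488 : cert_r488_hubSQ_hanK7R6_U6_r5_e4_so4blk)
    (h472 : cert_r472_pb2_tl_upper_n1_U8) (h428 : cert_r428_hubSQ_hanK7R6_U8_r5_e4_so4blk)
    (hLL : cert_feC1tt_3x2_tpm5o16_U15o2_b3o4_j290715)
    {s : ℝ} (hs : s ∈ Icc (-1 / 4 : ℝ) (-1 / 5)) {U : ℝ} (hU : U ∈ Icc (79 / 10 : ℝ) 8)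
    {β : ℝ} (hβ : (24 : ℝ) ≤ β)
    {ω₁ ω₂ : InfVolFermionState 2} (h₁ : ω₁.IsTranslationInvariant) (h₂ : ω₂.IsTranslationInvariant)
    (hρ₁ : 0 < ω₁.density) (hρ₁' : ω₁.density ≤ 1 / 4) (hρ₂ : 1 ≤ ω₂.density) (hρ₂' : ω₂.density < 2)
    {n : ℝ} (hn0 : 0 < n) (hn2 : n < 2) {lam : ℝ} (hl0 : 0 < lam) (hl1 : lam < 1) {Ls : ℕ → ℕ}
    (hLs : Tendsto Ls atTop atTop) :
    ¬ (mix lam hl0.le hl1.le ω₁ ω₂).IsTorusLimitOfMixture (sectorGibbsCount n) (fun L => sectorGibbsWeightTT' β 1 s U n L)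
      (fun L => sectorGibbsVectorTT' 1 s U n L) Ls := by
  refine psT_not_thermal_mix_on_cell_of_columns_hotAnchorSS 1 (s₁ := -1 / 4) (s₂ := -1 / 5) (U₁ := 79 / 10) (U₂ := 8)
    (n₁ := 1 / 4) (n₂ := 1) (a := 1 / 6) (b := 5 / 6) (β₀ := 24) (βh₁ := 8) (βh₂ := 3 / 4)
    (by norm_num) (by norm_num) (by norm_num) (by norm_num) (by norm_num) (by norm_num) (by norm_num) (by norm_num)
    (by norm_num) (by norm_num) (by norm_num) (by norm_num) hβ (by norm_num)
    (lsco78_capPlane_on_cell_of hVB (by norm_num) (by norm_num) (by norm_num))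
    (fun s hs => lsco_n1_lawAt_of hK29 hK8 h21 h487 h427 h488 h472 h428 (U₀ := 79 / 10) (by norm_num) s
      ⟨hs.1.trans' (by norm_num), hs.2.trans (by norm_num)⟩)
    (fun s hs => lsco_n1_law8_of hK8 h472 h428 s ⟨hs.1.trans' (by norm_num), hs.2.trans (by norm_num)⟩)
    (fun s hs U hU => lsco_dilute14_floor_right (n₁ := 1 / 4) (by norm_num) (by norm_num) s hs U (by linarith [hU.1]))
    (lsco_freeDiluteCap_1o4_right (by norm_num) (by norm_num) (by norm_num))
    (lsco_hotCap_n1_b3o4_j290715_on_band hLL (by norm_num) (by norm_num) (by norm_num))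
    ?_ ?_ ?_ ?_ hs hU h₁ h₂ hρ₁ hρ₁' hρ₂ hρ₂' hn0 hn2 hl0 hl1 hLs
  · intro s hs; obtain ⟨h1, h2⟩ := hs; push_cast; norm_num; nlinarith [h1, h2]
  · intro s hs; obtain ⟨h1, h2⟩ := hs; push_cast; norm_num; nlinarith [h1, h2]
  · intro s hs; obtain ⟨h1, h2⟩ := hs; push_cast; norm_num; nlinarith [h1, h2]
  · intro s hs; obtain ⟨h1, h2⟩ := hs; push_cast; norm_num; nlinarith [h1, h2]

/-- **`(≤ 1/4 | ≥ 1)` on `t′ ∈ [−1/4, −1/5] × U ∈ [79/10, 81/10]`, every `β ≥ 24`** (columns `β ≥ 24` ∣ above `β ≥ 16`; g24 cells file: `29`) — `T ≲ 164–193 K`. [cite: Israel1979, Thm. I.2.4] [cite: EmeryKivelsonLin1990, pp. 475–476] [cite: PoulinHastings2011, eqs. (3)–(8)] [cite: Griffiths1966, §II] [cite: Ruelle1969, §3.4] -/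
theorem lsco78_not_thermal_mix_le_1o4_ge_one_beta24_right_freeDilute (hVB : cert_obx32x4tpm1o4D1200_openbox_32x4_N112_planes)
    (hK29 : cert_laBoxE_K2diag_GU29o5n1tpm3o10_j295889_up) (hK8 : cert_laBoxE_K2diag_GU8n1tpm3o10_j299783_up)
    (h21 : cert_r21_luc_tl_upper_n1_U6) (h487 : cert_r487_hubSQ_hanK7R6_U10_r5_e4_so4blk)
    (h427 : cert_r427_hubSQ_hanK7_U5_r5_e4_so4blk) (h488 : cert_r488_hubSQ_hanK7R6_U6_r5_e4_so4blk)
    (h472 : cert_r472_pb2_tl_upper_n1_U8) (h428 : cert_r428_hubSQ_hanK7R6_U8_r5_e4_so4blk)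
    (hLL : cert_feC1tt_3x2_tpm5o16_U15o2_b3o4_j290715) (hC1 : cert_feC1tt_stair221_tpm1o4_b2_j300793)
    {s : ℝ} (hs : s ∈ Icc (-1 / 4 : ℝ) (-1 / 5)) {U : ℝ} (hU : U ∈ Icc (79 / 10 : ℝ) (81 / 10))
    {β : ℝ} (hβ : (24 : ℝ) ≤ β)
    {ω₁ ω₂ : InfVolFermionState 2} (h₁ : ω₁.IsTranslationInvariant) (h₂ : ω₂.IsTranslationInvariant)
    (hρ₁ : 0 < ω₁.density) (hρ₁' : ω₁.density ≤ 1 / 4) (hρ₂ : 1 ≤ ω₂.density) (hρ₂' : ω₂.density < 2)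
    {n : ℝ} (hn0 : 0 < n) (hn2 : n < 2) {lam : ℝ} (hl0 : 0 < lam) (hl1 : lam < 1) {Ls : ℕ → ℕ}
    (hLs : Tendsto Ls atTop atTop) :
    ¬ (mix lam hl0.le hl1.le ω₁ ω₂).IsTorusLimitOfMixture (sectorGibbsCount n) (fun L => sectorGibbsWeightTT' β 1 s U n L)
      (fun L => sectorGibbsVectorTT' 1 s U n L) Ls := by
  rcases le_total U 8 with hUl | hUr
  · exact lsco78_psTF_1o4_right_columns79o10_beta24 hVB hK29 hK8 h21 h487 h427 h488 h472 h428 hLL hs ⟨hU.1, hUl⟩ (hβ.trans' (by norm_num)) h₁ h₂ hρ₁ hρ₁' hρ₂ hρ₂' hn0 hn2 hl0 hl1 hLs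
  · exact lsco78_psTF_1o4_right_above81o10_beta16 hVB hK8 h472 h428 hC1 hs ⟨hUr, hU.2⟩ (hβ.trans' (by norm_num)) h₁ h₂ hρ₁ hρ₁' hρ₂ hρ₂' hn0 hn2 hl0 hl1 hLs

end Summit.Ventures.CertifiedManyBodySolver.Downfold
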